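import Mathlib
import Literature.Computability.AlgebraicComplexity.SimultaneousDoubleProduct
import Summits.MatrixMultiplication.MatrixMultiplication.Theorems.EisensteinValCertificatesHomocyclicSTPPDesignsStubLeafPacking
import Summits.MatrixMultiplication.MatrixMultiplication.Theorems.EisensteinValCertificatesHomocyclicSTPPDesignsStubLeafSwap

/-!
# Near-period packing of a clustered SDPP family (lead c5 calibration for the leaf
`ClusteredTwoFamilies`, crux `EisensteinValCertificates.HomocyclicSTPPDesigns`, stmt-MatrixMultiplication-10647)

The open leaf of the registered line (item stmt-MatrixMultiplication-18134) asks for SDPP families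
`(A_i, B_i)_{i<n}` in `ℤ/p` with `|A_i| = a`, `|B_i| = b`, `m` classes with pairwise disjoint
difference sets and `≥ d` members each, and merit `m·d^{2/3}·(ab)^{(2+ε)/3} > p`.  The landed packing
bookkeeping (`stub_leafPacking`, p155654) rests on ONE translate: for `b₀ ∈ B_k` the set
`T(b₀) := (⋃_{i≠k} A_i) − b₀` (of size `(n−1)·a`) misses the union `U` of the class difference sets
(of size `m·ab`), whence `(n−1)·a + m·ab ≤ p`.

This file adds the first STRUCTURAL consequence of clause (X) beyond disjointness.  Two such
translates `T(b₀)`, `T(b₁)` both live in the complement of `U`, so they overlap in at least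
`2(n−1)a + m·ab − p` points, and `z ↦ z + b₁` sends `T(b₀) ∩ T(b₁)` into `𝒜 ∩ (𝒜 + (b₁ − b₀))`,
`𝒜 := ⋃_i A_i`: EVERY difference `t = b₁ − b₀` of two points of `ℬ := ⋃_k B_k` is a NEAR-PERIOD of
`𝒜`,
  `#{x ∈ 𝒜 : x − t ∈ 𝒜} + p ≥ 2(n−1)·a + m·ab`            (`nearPeriod_translate_bound`).
Summing over `t` and double counting `Σ_t #{x ∈ 𝒜 : x − t ∈ 𝒜} = |𝒜|² = (na)²`
(`sum_card_filter_sub_mem`) gives the NEAR-PERIOD PACKING inequalities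

* general finite abelian group `H`, pigeonhole form (`nearPeriodPacking_general`): if `2·n·b > |H|`
  then every `t ∈ H` is such a difference and `|H|·(2(n−1)a + m·ab) ≤ |H|² + (na)²`;
* `ℤ/p`, Cauchy–Davenport form (`nearPeriodPacking_zmod`, registered calibration stub
  `stub_leafNearPeriodPacking`): with `K := min(p, 2nb − 1) ≤ |ℬ − ℬ|` (Mathlib
  `ZMod.cauchy_davenport`), `K·(2(n−1)a + m·ab) ≤ K·p + (na)²`; and the swapped form with the
  roles of `a` and `b` exchanged (`stub_leafSwap`).

Consequence for leaf witnesses (numbers, in the balanced normal form `a = b = s`, `x := ns/p`,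
`y := ms²/p`, merit constant `R := m³d²s⁴/p³ ≤ y·x²`): besides `x + y ≤ 1` (packing) one has
`y ≤ 1 − 3x/2 + O(1/n)` for `x ≤ 1/2` and `y ≤ (1 − x)² + O(1/n)` for `x ≥ 1/2`, so
`sup R = 16/243 ≈ 0.0658` (at `x = 4/9`, `y = 1/3`) instead of the packing value `4/27 ≈ 0.148`:
a witness at `ε` needs `(ab)^ε > 243/16 ≈ 15.2` up to `O(1/n)`, against `27/16` recorded in
`stub_leafVersusPowerGain`.  The census value `R = 0.0655` (`p = 13`, `s = 2`, `n = 3`,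
three translates of `({0,1},{0,2})`) sits at this ceiling.  Constants only: the leaf stays open.

Sources: H. Cohn, R. Kleinberg, B. Szegedy, C. Umans, FOCS 2005, §4 Def. 4.1 (clause (X)) and
the proof of Prop. 4.6 (disjointness); A. L. Cauchy (1813) / H. Davenport (1935) via Mathlib's
`ZMod.cauchy_davenport`.  The near-period argument itself is elementary and new here.
-/

set_option linter.dupNamespace false
-- (single-conjunct summit: the namespace repeats `MatrixMultiplication`)

namespace Summit.MatrixMultiplication.MatrixMultiplication.Theorems.HomocyclicSTPPDesigns.ClusteredCharts

open Literature.Computability.AlgebraicComplexity Finset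
open scoped Pointwise

section General

variable {H : Type*} [AddCommGroup H] [DecidableEq H]

/-- Double counting: `Σ_t #{x ∈ S : x − t ∈ S} = |S|²` in a finite abelian group (for fixed `x ∈ S`
the `t` with `x − t ∈ S` are the `|S|` values `x − y`, `y ∈ S`). [folklore] -/
theorem sum_card_filter_sub_mem [Fintype H] (S : Finset H) :
    ∑ t, (S.filter fun x => x - t ∈ S).card = S.card * S.card := by
  have h1 : ∀ t : H, (S.filter fun x => x - t ∈ S).card =
      ∑ x ∈ S, if x - t ∈ S then 1 else 0 := fun t => Finset.card_filter _ _
  simp_rw [h1]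
  rw [Finset.sum_comm]
  have h2 : ∀ x ∈ S, (∑ t : H, if x - t ∈ S then 1 else 0) = S.card := by
    intro x _
    rw [← Finset.card_filter]
    have he : (Finset.univ.filter fun t : H => x - t ∈ S) = S.image fun y => x - y := by
      ext t
      simp only [Finset.mem_filter, Finset.mem_univ, true_and, Finset.mem_image]
      constructor
      · intro ht
        exact ⟨x - t, ht, sub_sub_cancel x t⟩
      · rintro ⟨y, hy, rfl⟩
        rw [sub_sub_cancel]
        exact hy
    rw [he, Finset.card_image_of_injective _ sub_right_injective]
  rw [Finset.sum_congr rfl h2, Finset.sum_const, smul_eq_mul]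

variable {n : ℕ} {A B : Fin n → Finset H}

/-- The translate `T(b₀) = (⋃_{i≠k} A_i) − b₀` shifted back by `b₀` lies in `𝒜 = ⋃_i A_i`. [folklore] -/
theorem translate_add_mem_biUnion (k : Fin n) (b₀ : H) {z : H}
    (hz : z ∈ ((Finset.univ.erase k).biUnion A).image fun x => x - b₀) :
    z + b₀ ∈ Finset.univ.biUnion A := by
  rw [Finset.mem_image] at hz
  obtain ⟨x, hx, rfl⟩ := hz
  rw [Finset.mem_biUnion] at hx
  obtain ⟨i, _, hxi⟩ := hx
  rw [sub_add_cancel, Finset.mem_biUnion]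
  exact ⟨i, Finset.mem_univ i, hxi⟩

/-- **Near-period bound.**  In an SDPP family with `|A_i| = a ≥ 1`, `|B_i| = b ≥ 1` and a class map
with cross-class disjoint difference sets and non-empty classes, for `b₀ ∈ B_k`, `b₁ ∈ B_{k'}` the
difference `t = b₁ − b₀` is a near-period of `𝒜 = ⋃_i A_i`:
`#{x ∈ 𝒜 : x − t ∈ 𝒜} + |H| ≥ 2(n−1)·a + m·(ab)`.  Proof: both translates `T(b₀)`, `T(b₁)`
(each of size `(n−1)a`) miss the union `U` (size `m·ab`) of the class difference sets
(`leafPacking_disjoint_translate_left`), and `z ↦ z + b₁` maps `T(b₀) ∩ T(b₁)` injectively into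
`{x ∈ 𝒜 : x − t ∈ 𝒜}`. [cite: CohnKleinbergSzegedyUmans2005, §4 Def. 4.1] -/
theorem nearPeriod_translate_bound [Fintype H] {m a b d : ℕ} (cls : Fin n → Fin m)
    (hS : IsSDPP A B) (hb : 1 ≤ b) (hcard : ∀ i, (A i).card = a ∧ (B i).card = b)
    (hcl : ∀ i j, cls i ≠ cls j → Disjoint (A i - B i) (A j - B j)) (hd : 1 ≤ d)
    (hcls : ∀ c : Fin m, d ≤ (Finset.univ.filter fun i => cls i = c).card)
    {k k' : Fin n} {b₀ b₁ : H} (hb₀ : b₀ ∈ B k) (hb₁ : b₁ ∈ B k') :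
    2 * ((n - 1) * a) + m * (a * b) ≤
      ((Finset.univ.biUnion A).filter fun x => x - (b₁ - b₀) ∈ Finset.univ.biUnion A).card +
        Fintype.card H := by
  have hA : ∀ i, (A i).card = a := fun i => (hcard i).1
  have hB : ∀ i, (B i).card = b := fun i => (hcard i).2
  have hBne : ∀ i, (B i).Nonempty := fun i => Finset.card_pos.1 (by rw [hB i]; exact hb)
  -- one representative `t c` per class `c`, and the union `U` of their difference sets
  have hrep : ∀ c : Fin m, ∃ i, cls i = c := by
    intro c
    have hpos : 0 < (Finset.univ.filter fun i => cls i = c).card :=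
      lt_of_lt_of_le (Nat.lt_of_succ_le hd) (hcls c)
    obtain ⟨i, hi⟩ := Finset.card_pos.1 hpos
    rw [Finset.mem_filter] at hi
    exact ⟨i, hi.2⟩
  choose t ht using hrep
  have hdisjD : (↑(Finset.univ : Finset (Fin m)) : Set (Fin m)).PairwiseDisjoint
      fun c => A (t c) - B (t c) := by
    intro c _ c' _ hcc'
    exact hcl (t c) (t c') (by rw [ht c, ht c']; exact hcc')
  have hU : (Finset.univ.biUnion fun c => A (t c) - B (t c)).card = m * (a * b) := by
    rw [Finset.card_biUnion hdisjD]
    rw [Finset.sum_congr rfl fun c _ => show (A (t c) - B (t c)).card = a * b by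
      rw [leafPacking_card_sub hS (t c), hA, hB]]
    rw [Fin.sum_const, smul_eq_mul]
  set U := Finset.univ.biUnion fun c => A (t c) - B (t c) with hUdef
  set S₀ := ((Finset.univ.erase k).biUnion A).image fun x => x - b₀ with hS₀
  set S₁ := ((Finset.univ.erase k').biUnion A).image fun x => x - b₁ with hS₁
  set N := (Finset.univ.biUnion A).filter fun x => x - (b₁ - b₀) ∈ Finset.univ.biUnion A with hN
  have hS₀c : S₀.card = (n - 1) * a := leafPacking_card_translate_left hS hBne hA k b₀
  have hS₁c : S₁.card = (n - 1) * a := leafPacking_card_translate_left hS hBne hA k' b₁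
  -- both translates miss `U`
  have hdis : Disjoint (S₀ ∪ S₁) U := by
    rw [Finset.disjoint_union_left]
    constructor
    · rw [hUdef, Finset.disjoint_biUnion_right]
      intro c _
      exact leafPacking_disjoint_translate_left hS k hb₀ (t c)
    · rw [hUdef, Finset.disjoint_biUnion_right]
      intro c _
      exact leafPacking_disjoint_translate_left hS k' hb₁ (t c)
  have hunion : (S₀ ∪ S₁).card + U.card ≤ Fintype.card H := by
    rw [← Finset.card_union_of_disjoint hdis]
    exact Finset.card_le_univ _
  -- the intersection maps into the near-period set
  have hinter : (S₀ ∩ S₁).card ≤ N.card := by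
    refine Finset.card_le_card_of_injOn (fun z => z + b₁) (fun z hz => ?_)
      ((add_left_injective b₁).injOn)
    rw [Finset.mem_coe, Finset.mem_inter] at hz
    rw [Finset.mem_coe, hN, Finset.mem_filter]
    refine ⟨translate_add_mem_biUnion k' b₁ hz.2, ?_⟩
    have : z + b₁ - (b₁ - b₀) = z + b₀ := by abel
    rw [this]
    exact translate_add_mem_biUnion k b₀ hz.1
  have hie : S₀.card + S₁.card = (S₀ ∪ S₁).card + (S₀ ∩ S₁).card :=
    (Finset.card_union_add_card_inter S₀ S₁).symm
  -- assemble
  have h2 : 2 * ((n - 1) * a) = S₀.card + S₁.card := by rw [hS₀c, hS₁c]; ring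
  rw [h2, hie, ← hU]
  omega

/-- **Near-period packing, general pigeonhole form.**  In a finite additive abelian group `H`, an
SDPP family with `|A_i| = a ≥ 1`, `|B_i| = b ≥ 1`, a class map with cross-class disjoint difference
sets and classes of size `≥ d ≥ 1`, and `2·n·b > |H|` (so that every `t ∈ H` is a difference of two
points of `ℬ = ⋃_k B_k`, by pigeonhole) satisfies `|H|·(2(n−1)a + m·ab) ≤ |H|² + (na)²`.
[cite: CohnKleinbergSzegedyUmans2005, §4 Def. 4.1] -/
theorem nearPeriodPacking_general [Fintype H] {m a b d : ℕ} (cls : Fin n → Fin m)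
    (hS : IsSDPP A B) (ha : 1 ≤ a) (hb : 1 ≤ b) (hcard : ∀ i, (A i).card = a ∧ (B i).card = b)
    (hcl : ∀ i j, cls i ≠ cls j → Disjoint (A i - B i) (A j - B j)) (hd : 1 ≤ d)
    (hcls : ∀ c : Fin m, d ≤ (Finset.univ.filter fun i => cls i = c).card)
    (hbig : Fintype.card H < 2 * (n * b)) :
    Fintype.card H * (2 * ((n - 1) * a) + m * (a * b)) ≤
      Fintype.card H ^ 2 + (n * a) ^ 2 := by
  have hA : ∀ i, (A i).card = a := fun i => (hcard i).1
  have hB : ∀ i, (B i).card = b := fun i => (hcard i).2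
  have hAne : ∀ i, (A i).Nonempty := fun i => Finset.card_pos.1 (by rw [hA i]; exact ha)
  have hBne : ∀ i, (B i).Nonempty := fun i => Finset.card_pos.1 (by rw [hB i]; exact hb)
  -- `|𝒜| = n·a`, `|ℬ| = n·b`
  have hdisjA : (↑(Finset.univ : Finset (Fin n)) : Set (Fin n)).PairwiseDisjoint A :=
    fun i _ j _ hij => disjoint_left_of_simultaneous hS.2 hij (hBne j)
  have hdisjB : (↑(Finset.univ : Finset (Fin n)) : Set (Fin n)).PairwiseDisjoint B :=
    fun i _ j _ hij => disjoint_right_of_simultaneous hS.2 hij (hAne i)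
  have h𝒜 : (Finset.univ.biUnion A).card = n * a := by
    rw [Finset.card_biUnion hdisjA, Finset.sum_congr rfl fun i _ => hA i, Fin.sum_const,
      smul_eq_mul]
  have hℬ : (Finset.univ.biUnion B).card = n * b := by
    rw [Finset.card_biUnion hdisjB, Finset.sum_congr rfl fun i _ => hB i, Fin.sum_const,
      smul_eq_mul]
  -- every `t` is a difference `b₁ - b₀` of two points of `ℬ` (pigeonhole)
  have hdiff : ∀ t : H, ∃ k k' : Fin n, ∃ b₀ ∈ B k, ∃ b₁ ∈ B k', t = b₁ - b₀ := by
    intro t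
    set ℬ := Finset.univ.biUnion B with hℬdef
    have hnd : ¬ Disjoint ℬ (ℬ.image fun y => y + t) := by
      intro hdj
      have h := Finset.card_le_univ (ℬ ∪ ℬ.image fun y => y + t)
      rw [Finset.card_union_of_disjoint hdj, Finset.card_image_of_injective _
        (add_left_injective t), hℬ] at h
      omega
    rw [Finset.not_disjoint_iff] at hnd
    obtain ⟨y, hy, hy'⟩ := hnd
    rw [Finset.mem_image] at hy'
    obtain ⟨y₀, hy₀, rfl⟩ := hy'
    rw [hℬdef, Finset.mem_biUnion] at hy hy₀
    obtain ⟨k', _, hk'⟩ := hy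
    obtain ⟨k, _, hk⟩ := hy₀
    exact ⟨k, k', y₀, hk, y₀ + t, hk', by abel⟩
  -- sum the near-period bound over all `t`
  have hsum : ∑ t : H, (2 * ((n - 1) * a) + m * (a * b)) ≤
      ∑ t : H, (((Finset.univ.biUnion A).filter fun x =>
        x - t ∈ Finset.univ.biUnion A).card + Fintype.card H) := by
    refine Finset.sum_le_sum fun t _ => ?_
    obtain ⟨k, k', b₀, hb₀, b₁, hb₁, rfl⟩ := hdiff t
    exact nearPeriod_translate_bound cls hS hb hcard hcl hd hcls hb₀ hb₁
  rw [Finset.sum_const, smul_eq_mul, Finset.sum_add_distrib, sum_card_filter_sub_mem, h𝒜,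
    Finset.sum_const, smul_eq_mul, Finset.card_univ] at hsum
  nlinarith [hsum]

end General

/-! ## Prime cyclic groups: the Cauchy–Davenport form -/

/-- **Near-period packing in `ℤ/p`, Cauchy–Davenport form.**  For a prime `p`, an SDPP family
`(A_i, B_i)_{i<n}` in `ℤ/p` with `|A_i| = a ≥ 1`, `|B_i| = b ≥ 1`, a class map with cross-class
disjoint difference sets and classes of size `≥ d ≥ 1`: with `K := min(p, 2nb − 1)` (a lower bound
for `|ℬ − ℬ|`, `ℬ = ⋃_k B_k`, by Cauchy–Davenport) one has `K·(2(n−1)a + m·ab) ≤ K·p + (na)²`.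
Every `t ∈ ℬ − ℬ` is a near-period of `⋃ A_i` (`nearPeriod_translate_bound`), and the near-period
counts sum to `(na)²` over all of `ℤ/p`. [cite: CohnKleinbergSzegedyUmans2005, §4 Def. 4.1] -/
theorem nearPeriodPacking_zmod {p n m a b d : ℕ} (hp : p.Prime) {A B : Fin n → Finset (ZMod p)}
    (cls : Fin n → Fin m) (hS : IsSDPP A B) (ha : 1 ≤ a) (hb : 1 ≤ b)
    (hcard : ∀ i, (A i).card = a ∧ (B i).card = b)
    (hcl : ∀ i j, cls i ≠ cls j → Disjoint (A i - B i) (A j - B j)) (hd : 1 ≤ d)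
    (hcls : ∀ c : Fin m, d ≤ (Finset.univ.filter fun i => cls i = c).card) :
    min p (2 * (n * b) - 1) * (2 * ((n - 1) * a) + m * (a * b)) ≤
      min p (2 * (n * b) - 1) * p + (n * a) ^ 2 := by
  haveI : NeZero p := ⟨hp.ne_zero⟩
  haveI : Fact p.Prime := ⟨hp⟩
  rcases Nat.eq_zero_or_pos n with hn | hn
  · subst hn
    simp
  have hA : ∀ i, (A i).card = a := fun i => (hcard i).1
  have hB : ∀ i, (B i).card = b := fun i => (hcard i).2
  have hAne : ∀ i, (A i).Nonempty := fun i => Finset.card_pos.1 (by rw [hA i]; exact ha)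
  have hBne : ∀ i, (B i).Nonempty := fun i => Finset.card_pos.1 (by rw [hB i]; exact hb)
  have hdisjA : (↑(Finset.univ : Finset (Fin n)) : Set (Fin n)).PairwiseDisjoint A :=
    fun i _ j _ hij => disjoint_left_of_simultaneous hS.2 hij (hBne j)
  have hdisjB : (↑(Finset.univ : Finset (Fin n)) : Set (Fin n)).PairwiseDisjoint B :=
    fun i _ j _ hij => disjoint_right_of_simultaneous hS.2 hij (hAne i)
  have h𝒜 : (Finset.univ.biUnion A).card = n * a := by
    rw [Finset.card_biUnion hdisjA, Finset.sum_congr rfl fun i _ => hA i, Fin.sum_const,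
      smul_eq_mul]
  set ℬ := Finset.univ.biUnion B with hℬdef
  have hℬ : ℬ.card = n * b := by
    rw [hℬdef, Finset.card_biUnion hdisjB, Finset.sum_congr rfl fun i _ => hB i, Fin.sum_const,
      smul_eq_mul]
  have hℬne : ℬ.Nonempty := Finset.card_pos.1 (by rw [hℬ]; exact Nat.mul_pos hn hb)
  -- the difference set `E = ℬ + (-ℬ)` and its Cauchy–Davenport bound
  set E := ℬ + -ℬ with hEdef
  have hEcard : min p (2 * (n * b) - 1) ≤ E.card := by
    have h := ZMod.cauchy_davenport hp hℬne (Finset.neg_nonempty_iff.2 hℬne)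
    rw [Finset.card_neg, hℬ] at h
    have h2 : n * b + n * b - 1 = 2 * (n * b) - 1 := by omega
    rw [h2] at h
    exact h
  -- every `t ∈ E` is a difference `b₁ - b₀`
  have hdiff : ∀ t ∈ E, ∃ k k' : Fin n, ∃ b₀ ∈ B k, ∃ b₁ ∈ B k', t = b₁ - b₀ := by
    intro t ht
    rw [hEdef, Finset.mem_add] at ht
    obtain ⟨b₁, hb₁, y, hy, rfl⟩ := ht
    rw [Finset.mem_neg] at hy
    obtain ⟨y₁, hy₁, rfl⟩ := hy
    rw [hℬdef, Finset.mem_biUnion] at hb₁ hy₁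
    obtain ⟨k', _, hk'⟩ := hb₁
    obtain ⟨k, _, hk⟩ := hy₁
    exact ⟨k, k', y₁, hk, b₁, hk', by abel⟩
  -- sum the near-period bound over `t ∈ E`
  have hsum : ∑ t ∈ E, (2 * ((n - 1) * a) + m * (a * b)) ≤
      ∑ t ∈ E, (((Finset.univ.biUnion A).filter fun x =>
        x - t ∈ Finset.univ.biUnion A).card + p) := by
    refine Finset.sum_le_sum fun t ht => ?_
    obtain ⟨k, k', b₀, hb₀, b₁, hb₁, rfl⟩ := hdiff t ht
    have h := nearPeriod_translate_bound cls hS hb hcard hcl hd hcls hb₀ hb₁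
    rw [ZMod.card p] at h
    exact h
  have hpart : ∑ t ∈ E, ((Finset.univ.biUnion A).filter fun x =>
      x - t ∈ Finset.univ.biUnion A).card ≤ (n * a) ^ 2 := by
    have h := Finset.sum_le_sum_of_subset_of_nonneg (Finset.subset_univ E)
      (f := fun t => ((Finset.univ.biUnion A).filter fun x =>
        x - t ∈ Finset.univ.biUnion A).card) (fun _ _ _ => Nat.zero_le _)
    rw [sum_card_filter_sub_mem, h𝒜, ← pow_two] at h
    exact h
  rw [Finset.sum_const, smul_eq_mul, Finset.sum_add_distrib, Finset.sum_const, smul_eq_mul] at hsum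
  -- `hsum : |E|·X ≤ Σ + |E|·p`, `hpart : Σ ≤ (na)²`; replace `|E|` by `K ≤ |E|`
  set K := min p (2 * (n * b) - 1) with hK
  set X := 2 * ((n - 1) * a) + m * (a * b) with hX
  have hEX : E.card * X ≤ (n * a) ^ 2 + E.card * p := by omega
  rcases le_or_gt X p with hXp | hXp
  · calc K * X ≤ K * p := Nat.mul_le_mul_left K hXp
      _ ≤ K * p + (n * a) ^ 2 := Nat.le_add_right _ _
  · -- `X > p`: `K·(X - p) ≤ |E|·(X - p) ≤ (na)²`
    have h1 : K * (X - p) ≤ E.card * (X - p) := Nat.mul_le_mul_right _ hEcard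
    have h2 : E.card * (X - p) ≤ (n * a) ^ 2 := by
      rw [Nat.mul_sub]
      omega
    have h3 : K * X = K * (X - p) + K * p := by
      rw [← Nat.mul_add, Nat.sub_add_cancel hXp.le]
    omega

/-- **Near-period packing of a clustered SDPP family in `ℤ/p`** (lead c5 calibration stub
`stub_leafNearPeriodPacking` of line `registered`, crux stmt-MatrixMultiplication-10647; same binders
as `stub_leafPacking`): with `K := min(p, 2nb − 1)` and `K' := min(p, 2na − 1)`,
`K·(2(n−1)a + m·ab) ≤ K·p + (na)²` and, swapping the roles of `A` and `B` (`stub_leafSwap`),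
`K'·(2(n−1)b + m·ab) ≤ K'·p + (nb)²`; in particular (pigeonhole form) `2nb > p` forces
`p·(2(n−1)a + m·ab) ≤ p² + (na)²`.  For balanced leaf witnesses (`x = ns/p`, `y = ms²/p`) this caps
the merit constant `m³d²s⁴/p³ ≤ yx²` at `16/243 + O(1/n)` instead of `4/27`.
[cite: CohnKleinbergSzegedyUmans2005, §4 Def. 4.1] -/
theorem stub_leafNearPeriodPacking :
    ∀ (p n m a b d : ℕ), p.Prime → ∀ (A B : Fin n → Finset (ZMod p)) (cls : Fin n → Fin m),
      IsSDPP A B → 1 ≤ a → 1 ≤ b → (∀ i, (A i).card = a ∧ (B i).card = b) →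
      (∀ i j, cls i ≠ cls j → Disjoint (A i - B i) (A j - B j)) →
      1 ≤ d → (∀ c : Fin m, d ≤ (Finset.univ.filter fun i => cls i = c).card) →
      min p (2 * (n * b) - 1) * (2 * ((n - 1) * a) + m * (a * b)) ≤
          min p (2 * (n * b) - 1) * p + (n * a) ^ 2 ∧
        min p (2 * (n * a) - 1) * (2 * ((n - 1) * b) + m * (a * b)) ≤
          min p (2 * (n * a) - 1) * p + (n * b) ^ 2 ∧
        (p < 2 * (n * b) → p * (2 * ((n - 1) * a) + m * (a * b)) ≤ p ^ 2 + (n * a) ^ 2) := by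
  intro p n m a b d hp A B cls hS ha hb hcard hcl hd hcls
  refine ⟨nearPeriodPacking_zmod hp cls hS ha hb hcard hcl hd hcls, ?_, ?_⟩
  · -- swap `A` and `B`
    obtain ⟨hS', hcl'⟩ := stub_leafSwap p n m A B cls hS hcl
    have hcard' : ∀ i, (B i).card = b ∧ (A i).card = a := fun i => ⟨(hcard i).2, (hcard i).1⟩
    have h := nearPeriodPacking_zmod hp cls hS' hb ha hcard' hcl' hd hcls
    rw [Nat.mul_comm b a] at h
    exact h
  · intro hbig
    haveI : NeZero p := ⟨hp.ne_zero⟩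
    have h := nearPeriodPacking_general cls hS ha hb hcard hcl hd hcls
      (by rw [ZMod.card p]; exact hbig)
    rw [ZMod.card p] at h
    exact h

end Summit.MatrixMultiplication.MatrixMultiplication.Theorems.HomocyclicSTPPDesigns.ClusteredCharts
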